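import Summits.QuantumFields.BalabanUV.T4Continuum.Spine.NE3.LandauProjectionB8
import Summits.QuantumFields.BalabanUV.T4Continuum.Support.NE3HilbertSchmidtTorus
import HarnessLib

/-!
# T⁴ programme, node NE3 — census R32 (exact half, step 1): B8's GAUGE CONDITION (1.38) MAKES THE GAUGE POTENTIAL OF A DIRECTION
# `Δ_W`-ORTHOGONAL TO THE RESTRICTED GAUGE ALGEBRA `N(Q′(W))`, HENCE `Δ_W²`-MINIMAL IN ITS RESTRICTED ORBIT — every unitary periodic background

Cell `pub-balaban-gaps` (track G2, seat `ne3`; writer prover-pub-balaban-gaps-ne3-g5-0, 2026-08-23), census `run/shared/lean/pub/pub-balaban-gaps/ne/NE3.md` §4 R32 ∕ §11.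
WHAT.  [Balaban1985RegularSpaces] (1.38) «R(U₀)D*A = 0», typed in the tree as `IsLandauB8 L N k W Y` (`Y ⊥ D_W(Δ_W μ)` over one period for every `μ` in
`N(Q′(W)) = avgKernelGauges L N k W` — skew, periodic, nested transported block mean zero), READ ON THE GAUGE POTENTIAL: if `Y = η + D_W ζ` with `covDiv W η = 0` on the period box
(a covariant Hodge split, `NE3SpectralCutTorus.exists_covHodge_skew`), then
**`sum_hsR_covLapSite_eq_zero_of_isLandauB8`**: `Σ_{x ∈ periodBox (N·L^k)} hsR (Δ_W ζ x) (Δ_W μ x) = 0` for every `μ ∈ N(Q′(W))` (`Δ_W = covLapSite W`), and consequently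
**`sum_nhsNormSq_covLapSite_le_of_isLandauB8`**: `Σ nhsNormSq (Δ_W ζ) ≤ Σ nhsNormSq (Δ_W (ζ + μ))` for every `μ ∈ N(Q′(W))` — the potential of a (1.38)-Landau direction MINIMISES
the `Δ_W`-energy (the ℓ²-mass of the covariant divergence) over its restricted gauge orbit `ζ + N(Q′(W))` (with the Pythagoras identity
**`sum_nhsNormSq_covLapSite_add_of_isLandauB8`**).  At the flat background this says: the exact potential of `Y ∈ slicB8(1)` is the `Δ²`-MINIMAL EXTENSION OF ITS BLOCK MEANS —
the structural input of the exact half of census R32 (flat (P♮) on `slicB8` for `N ≥ 2`; the analytic inputs still missing are a C¹ block-mean interpolant and its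
`‖Δũ‖`-bound, census R32).  MECHANISM: the torus summation by parts `NE3LandauOrbit.sum_hsR_gaugeDir` turns (1.38) into `Σ hsR (covDiv W Y) (Δ_W μ) = 0`, and
`covDiv W Y = covDiv W η + covDiv W (D_W ζ) = Δ_W ζ` on the box (`covDiv_add_fun`, `covDiv_gaugeDir_eq_covLapSite`); then `covLapSite_add` + `nhsNormSq_add`.

CONTENT (0 sorry, no `def`): **`sum_hsR_covLapSite_eq_zero_of_isLandauB8`**, **`sum_nhsNormSq_covLapSite_add_of_isLandauB8`**,
**`sum_nhsNormSq_covLapSite_le_of_isLandauB8`** [folklore].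

HONEST FRAMING.  Linear algebra of OUR typing of (1.38) on OUR objects, at every unitary periodic background; nothing of Bałaban's is proved; (P♮) on `slicB8` and
**NE3 are NOT proved**; spine PROVED 0∕9; finite T⁴ rung (B)+1 — NOT continuum YM on ℝ⁴, NOT infinite volume, NOT mass gap, NOT Clay.
PLACEMENT: `Summits/QuantumFields/BalabanUV/T4Continuum/Spine/NE3/`.
-/

set_option autoImplicit false

open scoped BigOperators Matrix Matrix.Norms.L2Operator
open Finset

namespace Summit.QuantumFields.BalabanUV.T4Continuum.NE3.SlicB8LandauMinimal

open Literature.MathematicalPhysics.QuantumFieldTheory.Balaban1983to89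
open B7Prop1Explicit B7Prop2Explicit MatrixNorms
open T4AveragingDeficitWall (Ad IsUnitaryCfg IsSkewDir)
open T4AveragingDeficitWallBoundary (IsPeriodicCfg periodBox mem_periodBox)
open AveragingDeficitPeriodicCounting (IsPeriodicDir)
open BlockAveragePushDirGauge (gaugeDir isPeriodicDir_gaugeDir)
open NE3CovariantCalculus (hsR hsR_self hsR_comm)
open NE3CovariantWeitzenbock (covDiv)
open NE3LandauOrbit (sum_hsR_gaugeDir covDiv_add_period nhsNormSq_add)
open NE3HilbertSchmidtTorus (covDiv_add_fun)
open NE3.PairLandauB8 (avgKernelGauges covLapSite IsLandauB8)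
open NE3.LandauProjectionB8 (covDiv_gaugeDir_eq_covLapSite covLapSite_add covLapSite_add_period)

noncomputable section

variable {d : ℕ} {n : Type*} [Fintype n] [DecidableEq n]

/-- **(1.38) ON THE POTENTIAL: `Δ_W ζ ⊥ Δ_W N(Q′(W))`** (module docstring): for a unitary `(N·L^k)`-periodic background `W`, a periodic direction `Y = η + D_W ζ` with
`covDiv W η = 0` on the period box and `IsLandauB8 L N k W Y`, and every `μ ∈ avgKernelGauges L N k W`:
`Σ_{x ∈ periodBox (N·L^k)} hsR (covLapSite W ζ x) (covLapSite W μ x) = 0`. [folklore] -/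
theorem sum_hsR_covLapSite_eq_zero_of_isLandauB8 {L N k : ℕ} (hP : 1 ≤ N * L ^ k)
    {W : Site d → Fin d → (Matrix n n ℂ)ˣ} (hWu : IsUnitaryCfg W) (hWP : IsPeriodicCfg W ((N * L ^ k : ℕ) : ℤ))
    {Y η : Site d → Fin d → Matrix n n ℂ} {ζ : Site d → Matrix n n ℂ} (hYP : IsPeriodicDir Y ((N * L ^ k : ℕ) : ℤ))
    (hsplit : ∀ (x : Site d) (κ : Fin d), Y x κ = η x κ + gaugeDir W ζ x κ)
    (hη : ∀ x ∈ periodBox (d := d) (N * L ^ k), covDiv W η x = 0)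
    (hLan : IsLandauB8 (d := d) L N k W Y) {μ : Site d → Matrix n n ℂ} (hμ : μ ∈ avgKernelGauges (d := d) (n := n) L N k W) :
    ∑ x ∈ periodBox (d := d) (N * L ^ k), hsR (covLapSite W ζ x) (covLapSite W μ x) = 0 := by
  have hμP := hμ.2.1
  have h0 := hLan μ hμ
  rw [sum_hsR_gaugeDir hP hWu hYP (covLapSite_add_period hWP hμP)] at h0
  rw [← h0]
  refine Finset.sum_congr rfl fun x hx => ?_
  have hYfun : Y = fun y κ => η y κ + gaugeDir W ζ y κ := by funext y κ; exact hsplit y κ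
  have hdiv : covDiv W Y x = covLapSite W ζ x := by
    rw [hYfun, covDiv_add_fun, hη x hx, zero_add, ← covDiv_gaugeDir_eq_covLapSite]
  rw [hdiv]

/-- **PYTHAGORAS IN THE RESTRICTED ORBIT**: under the same hypotheses, `Σ nhsNormSq (Δ_W (ζ + μ)) = Σ nhsNormSq (Δ_W ζ) + Σ nhsNormSq (Δ_W μ)` for every
`μ ∈ N(Q′(W))`. [folklore] -/
theorem sum_nhsNormSq_covLapSite_add_of_isLandauB8 {L N k : ℕ} (hP : 1 ≤ N * L ^ k)
    {W : Site d → Fin d → (Matrix n n ℂ)ˣ} (hWu : IsUnitaryCfg W) (hWP : IsPeriodicCfg W ((N * L ^ k : ℕ) : ℤ))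
    {Y η : Site d → Fin d → Matrix n n ℂ} {ζ : Site d → Matrix n n ℂ} (hYP : IsPeriodicDir Y ((N * L ^ k : ℕ) : ℤ))
    (hsplit : ∀ (x : Site d) (κ : Fin d), Y x κ = η x κ + gaugeDir W ζ x κ)
    (hη : ∀ x ∈ periodBox (d := d) (N * L ^ k), covDiv W η x = 0)
    (hLan : IsLandauB8 (d := d) L N k W Y) {μ : Site d → Matrix n n ℂ} (hμ : μ ∈ avgKernelGauges (d := d) (n := n) L N k W) :
    ∑ x ∈ periodBox (d := d) (N * L ^ k), nhsNormSq (covLapSite W (ζ + μ) x)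
      = ∑ x ∈ periodBox (d := d) (N * L ^ k), nhsNormSq (covLapSite W ζ x)
        + ∑ x ∈ periodBox (d := d) (N * L ^ k), nhsNormSq (covLapSite W μ x) := by
  have horth := sum_hsR_covLapSite_eq_zero_of_isLandauB8 hP hWu hWP hYP hsplit hη hLan hμ
  have h : ∀ x : Site d, nhsNormSq (covLapSite W (ζ + μ) x)
      = nhsNormSq (covLapSite W ζ x) + nhsNormSq (covLapSite W μ x) + 2 * hsR (covLapSite W ζ x) (covLapSite W μ x) := by
    intro x
    rw [covLapSite_add, Pi.add_apply, nhsNormSq_add]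
  rw [Finset.sum_congr rfl fun x _ => h x, Finset.sum_add_distrib, Finset.sum_add_distrib, ← Finset.mul_sum, horth, mul_zero, add_zero]

/-- **THE (1.38)-POTENTIAL MINIMISES THE `Δ_W`-ENERGY OVER ITS RESTRICTED GAUGE ORBIT** (module docstring): under the same hypotheses,
`Σ nhsNormSq (Δ_W ζ) ≤ Σ nhsNormSq (Δ_W (ζ + μ))` for every `μ ∈ N(Q′(W))` — at the flat background: the exact potential of `Y ∈ slicB8(1)` is the `Δ²`-minimal extension of
its block means. [folklore] -/
theorem sum_nhsNormSq_covLapSite_le_of_isLandauB8 {L N k : ℕ} (hP : 1 ≤ N * L ^ k)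
    {W : Site d → Fin d → (Matrix n n ℂ)ˣ} (hWu : IsUnitaryCfg W) (hWP : IsPeriodicCfg W ((N * L ^ k : ℕ) : ℤ))
    {Y η : Site d → Fin d → Matrix n n ℂ} {ζ : Site d → Matrix n n ℂ} (hYP : IsPeriodicDir Y ((N * L ^ k : ℕ) : ℤ))
    (hsplit : ∀ (x : Site d) (κ : Fin d), Y x κ = η x κ + gaugeDir W ζ x κ)
    (hη : ∀ x ∈ periodBox (d := d) (N * L ^ k), covDiv W η x = 0)
    (hLan : IsLandauB8 (d := d) L N k W Y) {μ : Site d → Matrix n n ℂ} (hμ : μ ∈ avgKernelGauges (d := d) (n := n) L N k W) :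
    ∑ x ∈ periodBox (d := d) (N * L ^ k), nhsNormSq (covLapSite W ζ x)
      ≤ ∑ x ∈ periodBox (d := d) (N * L ^ k), nhsNormSq (covLapSite W (ζ + μ) x) := by
  rw [sum_nhsNormSq_covLapSite_add_of_isLandauB8 hP hWu hWP hYP hsplit hη hLan hμ]
  have h0 : 0 ≤ ∑ x ∈ periodBox (d := d) (N * L ^ k), nhsNormSq (covLapSite W μ x) :=
    Finset.sum_nonneg fun x _ => nhsNormSq_nonneg _
  linarith

end

end Summit.QuantumFields.BalabanUV.T4Continuum.NE3.SlicB8LandauMinimal
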